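import Literature.Computability.AlgebraicComplexity.CwSquareFlattening
import HarnessLib

/-!
# A uniform `p = 1` restriction for `T_{cw,q}^{⊠2}`: the matrix, its entries, and the minor criterion

Topic: `Literature/Computability/AlgebraicComplexity`. Towards the general case `q ≥ 5` of the square
part of Conner–Gesmundo–Landsberg–Ventura 2022, Thm. 1.2 (`bR(T_{cw,q}^{⊠2}) = (q+2)²` for `q > 2`):
the lower bound is a `p = 1` Koszul-flattening bound `rank(K_φ(T_{cw,q}^{⊠2})) ≥ 2(q+2)² - 1` for a
restriction `φ : A ⊗ A → ℂ³` (CGLV §4.3: "This provides the lower bound … and equality follows because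
of the submultiplicativity"). The source uses an `𝔖_{q-3}`-invariant `φ₂` and a computer-assisted
isotypic computation (§4.5, §7); we use instead the following explicit `φ` (found by a computer
search for a flattening matrix that is a permuted triangular matrix of full rank `2(q+2)²`, uniformly
in `q`), for which the rank bound has a purely combinatorial, `q`-uniform certificate
(files `CwSquareGenericTables.lean`, `…Transfer.lean`, `…Rank.lean`):

  `φ₀(x,y) = [x ≤ 1][y ≤ 1]`,
  `φ₁(x,y) = 2[x = 3][y = 0] + [x = 0][y = 2] - [x = 1][y ≥ 4]`,
  `φ₂(x,y) = [x ≥ 4][y = 0] + [x = 0][y = 1] + 2[x = 3][y = 3] - [x ≥ 4][x = y] + [x = 2][y = 2]`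

(`x, y ∈ {0,…,q}` the two tensor-factor indices of `a_x ⊗ a_y ∈ A ⊗ A`). This file (all PROVED):

* `CwSqGen.gphi`, `CwSqGen.genM q` — the restriction matrix `M : ℤ^{(q+1)²} → ℤ³`.
* `CwSqGen.psub31`, `CwSqGen.psub32`, `CwSqGen.inc1`, `CwSqGen.inc1_eq` — `Λ¹ ℤ³ → Λ² ℤ³` in coordinates.
* `CwSqGen.kgen q r c` — the entry of the Koszul flattening `K_M(T_{cw,q}^{⊠2})` (`p = 1`) at row
  `r = (t, (c₁,c₂))` (`t` = index of the `2`-subset), column `c = (s, (b₁,b₂))`, as the three-term sum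
  `∑_j inc1 t s j · φ_j(α(b₁,c₁), α(b₂,c₂))`; `CwSqGen.kgen_eq` identifies it with the tree's
  `koszulFlattening 1 (genM q).mulVecLin (cwSq ℤ q)` (entry formula of `CwSquareFlattening.lean`).
* `le_algBorderRank_sq_cwTensor_of_det_ne_zero'` — the minor criterion of `CwSquareFlattening.lean`
  for a minor indexed by an arbitrary finite type.

## References

* A. Conner, F. Gesmundo, J. M. Landsberg, E. Ventura, *Rank and border rank of Kronecker powers of
  tensors and Strassen's laser method*, comput. complexity 31 (2022), arXiv:1909.04785, Thm. 1.2 /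
  Thm. 2.1, §4.1 (eq. (kozinq)), §4.3, §4.5. [ConnerGesmundoLandsbergVentura2022]
-/

open scoped BigOperators
open Matrix

namespace Literature.Computability.AlgebraicComplexity

namespace CwSqGen

/-! ## The restriction `φ` -/

/-- The three components `φ₀, φ₁, φ₂` of the restriction `A ⊗ A → ℤ³`, as functions of the two
indices `x, y ∈ ℕ` of `a_x ⊗ a_y`. [cite: ConnerGesmundoLandsbergVentura2022, §4.3] -/
def gphi (j : Fin 3) (x y : ℕ) : ℤ :=
  match j with
  | ⟨0, _⟩ => if x ≤ 1 ∧ y ≤ 1 then 1 else 0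
  | ⟨1, _⟩ => (if x = 3 ∧ y = 0 then 2 else 0) + (if x = 0 ∧ y = 2 then 1 else 0) -
      (if x = 1 ∧ 4 ≤ y then 1 else 0)
  | ⟨_ + 2, _⟩ => (if 4 ≤ x ∧ y = 0 then 1 else 0) + (if x = 0 ∧ y = 1 then 1 else 0) +
      (if x = 3 ∧ y = 3 then 2 else 0) - (if 4 ≤ x ∧ x = y then 1 else 0) +
      (if x = 2 ∧ y = 2 then 1 else 0)

/-- The restriction matrix `M : ℤ^{(q+1)²} → ℤ³`, `M_{j,(x,y)} = φ_j(x,y)`.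
[cite: ConnerGesmundoLandsbergVentura2022, §4.3] -/
def genM (q : ℕ) : Matrix (Fin 3) (Fin (q + 1) × Fin (q + 1)) ℤ :=
  Matrix.of fun j a => gphi j a.1.val a.2.val

/-- Entries of `genM`. [cite: ConnerGesmundoLandsbergVentura2022, §4.3] -/
@[simp] theorem genM_apply (q : ℕ) (j : Fin 3) (a : Fin (q + 1) × Fin (q + 1)) :
    genM q j a = gphi j a.1.val a.2.val := rfl

/-! ## `p = 1` in coordinates -/

/-- The three `1`-subsets of `Fin 3`. [folklore] -/
def psub31 : Fin 3 → PSub 3 1 := ![⟨{0}, by decide⟩, ⟨{1}, by decide⟩, ⟨{2}, by decide⟩]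

/-- The three `2`-subsets of `Fin 3`, in lexicographic order `{0,1}, {0,2}, {1,2}`. [folklore] -/
def psub32 : Fin 3 → PSub 3 2 := ![⟨{0, 1}, by decide⟩, ⟨{0, 2}, by decide⟩, ⟨{1, 2}, by decide⟩]

/-- The signed incidence table of `e_j ∧ · : Λ¹ → Λ²` on `ℤ³`: `inc1 t s j = ε({s},j)` if
`psub32 t = {s, j}`, `j ≠ s`, else `0`. [folklore] -/
def inc1 : Fin 3 → Fin 3 → Fin 3 → ℤ :=
  ![![![0, -1, 0], ![1, 0, 0], ![0, 0, 0]],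
    ![![0, 0, -1], ![0, 0, 0], ![1, 0, 0]],
    ![![0, 0, 0], ![0, 0, -1], ![0, 1, 0]]]

/-- The table is the signed incidence of the wedge. [folklore] -/
theorem inc1_eq : ∀ (t s j : Fin 3),
    inc1 t s j =
      if j ∉ (psub31 s).1 ∧ (psub32 t).1 = insert j (psub31 s).1 then koszulSign (psub31 s).1 j
      else 0 := by
  decide

variable {q : ℕ}

/-- Rows of the flattening in coordinates: `(t, (c₁, c₂))` stands for the row
`(psub32 t, (c₁, c₂)) ∈ Λ²ℤ³ × C^{⊗2}`. [folklore] -/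
abbrev Row (q : ℕ) : Type := Fin 3 × (Fin (q + 1) × Fin (q + 1))

/-- Columns of the flattening in coordinates: `(s, (b₁, b₂))` stands for `(psub31 s, (b₁, b₂))`.
[folklore] -/
abbrev Col (q : ℕ) : Type := Fin 3 × (Fin (q + 1) × Fin (q + 1))

/-- The row index of the tree's Koszul flattening named by `r`. [folklore] -/
def rowIdx (r : Row q) : PSub 3 2 × (Fin (q + 1) × Fin (q + 1)) := (psub32 r.1, r.2)

/-- The column index of the tree's Koszul flattening named by `c`. [folklore] -/
def colIdx (c : Col q) : PSub 3 1 × (Fin (q + 1) × Fin (q + 1)) := (psub31 c.1, c.2)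

/-- **The entry function** of `K_M(T_{cw,q}^{⊠2})`, `p = 1`, `M = genM q`:
`kgen q (t,(c₁,c₂)) (s,(b₁,b₂)) = ∑_j inc1 t s j · φ_j(α(b₁,c₁), α(b₂,c₂))`.
[cite: ConnerGesmundoLandsbergVentura2022, §4.3] -/
def kgen (q : ℕ) (r : Row q) (c : Col q) : ℤ :=
  ∑ j : Fin 3, inc1 r.1 c.1 j * phiVal (genM q) j c.2 r.2

/-- `kgen` computes the entries of the Koszul flattening.
[cite: ConnerGesmundoLandsbergVentura2022, §4.3] -/
theorem kgen_eq (r : Row q) (c : Col q) :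
    kgen q r c = koszulFlattening 1 (genM q).mulVecLin (cwSq ℤ q) (rowIdx r) (colIdx c) := by
  rw [kgen, rowIdx, colIdx, koszulFlattening_cwSq_apply]
  refine Finset.sum_congr rfl fun j _ => ?_
  rw [inc1_eq]
  split_ifs <;> simp

end CwSqGen

/-! ## The minor criterion for an arbitrary index type -/

/-- **The minor criterion** (`CwSquareFlattening.le_algBorderRank_sq_cwTensor_of_det_ne_zero`) for a
minor indexed by an arbitrary finite type `ι`: a non-zero `ι × ι` minor of the integer Koszul
flattening `K_M(T_{cw,q}^{⊠2})` with `binom(2p,p)(b-1) < |ι|` gives `b ≤ bR(T_{cw,q}^{⊠2})`.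
[cite: ConnerGesmundoLandsbergVentura2022, §4.1 eq. (kozinq)] -/
theorem le_algBorderRank_sq_cwTensor_of_det_ne_zero' {q : ℕ} (p : ℕ)
    (M : Matrix (Fin (2 * p + 1)) (Fin (q + 1) × Fin (q + 1)) ℤ) {ι : Type*} [Fintype ι]
    [DecidableEq ι] (r : ι → PSub (2 * p + 1) (p + 1) × (Fin (q + 1) × Fin (q + 1)))
    (c : ι → PSub (2 * p + 1) p × (Fin (q + 1) × Fin (q + 1)))
    (hdet : ((koszulFlattening p M.mulVecLin (cwSq ℤ q)).submatrix r c).det ≠ 0) {b : ℕ}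
    (hb : (2 * p).choose p * (b - 1) < Fintype.card ι) :
    b ≤ algBorderRank (kroneckerPow (cwTensor ℂ q) 2) := by
  classical
  set e := Fintype.equivFin ι
  refine le_algBorderRank_sq_cwTensor_of_det_ne_zero p M (r ∘ e.symm) (c ∘ e.symm) ?_
    (by simpa using hb)
  have h : (koszulFlattening p M.mulVecLin (cwSq ℤ q)).submatrix (r ∘ e.symm) (c ∘ e.symm) =
      ((koszulFlattening p M.mulVecLin (cwSq ℤ q)).submatrix r c).submatrix e.symm e.symm := rfl
  rw [h, Matrix.det_submatrix_equiv_self]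
  exact hdet

end Literature.Computability.AlgebraicComplexity
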